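import Summits.AtomisticToContinuum.FouriersLaw.Theses.BondHeatUncertainty
import Summits.AtomisticToContinuum.FouriersLaw.Theorems.BondHeatUncertaintyLinearResponseFTURSteadyHeatRatesHelper2
import Summits.AtomisticToContinuum.FouriersLaw.Theorems.BondHeatUncertaintyLinearResponseFTURSteadyHeatRatesHelper3
import Summits.AtomisticToContinuum.FouriersLaw.Theorems.BondHeatUncertaintySubdiffusiveBondHeatBathBondReductionGenerator

/-!
# Equality of the steady bond currents (helper 4 for `stub_steadyHeatRates`)

Helper file for crux `stmt-AtomisticToContinuum-9122` (`BondHeatUncertainty.LinearResponseFTUR`), line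
`lebesgue-flip-duality`, stub `stub_steadyHeatRates`. For a law `μ` on the phase space of the pinned chain
(`N ≥ 2` sites) that is weakly stationary (`∫ L g dμ = 0` for `g ∈ C_c^∞`) and has all polynomial energy moments,
weak stationarity tested on the elementary observables (helpers 2, 3) gives the local conservation laws

* `∫ p_i U'(q_i) dμ = 0`, `∫ (p_{i+1} - p_i) V'(q_{i+1} - q_i) dμ = 0`, `∫ p_i ∂_{q_i}H dμ = 0` at interior sites;

whence, with `W_i = ∫ p_i ∂_{q_i}H dμ` and the closed form of `∂_{q_i}H`:

* `pinnedChain_steadyCurrents` (registered sub-goal) — every real bond carries the same mean current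
  `∫ j_b dμ = W_0`, the total current is `(N - 1) W_0`, and `W_{N-1} = -W_0` (what enters at the left leaves at
  the right).

Nothing here closes an item.
-/

noncomputable section

namespace Summit.AtomisticToContinuum.FouriersLaw.Theorems.LinearResponseFTUR

open MeasureTheory Filter Topology Set Finset
open scoped ContDiff NNReal ENNReal
open Literature.MathematicalPhysics.KineticTheory
open Literature.MathematicalPhysics.KineticTheory.HeatConduction
open Summit.AtomisticToContinuum.FouriersLaw.Theorems.SubdiffusiveBondHeat

variable {N : ℕ}

/-! ### The force at a site in terms of its neighbours -/

/-- `∂Φ/∂q_j = U'(q_j) + V'(q_j - q_i) - V'(q_k - q_j)` at an interior site `j` with neighbours `i = j - 1`,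
`k = j + 1`. [folklore] -/
theorem dPotential_interior (P : OscillatorChain) {i j k : Fin N} (hij : j.val = i.val + 1)
    (hjk : k.val = j.val + 1) (q : Fin N → ℝ) :
    P.dPotential N j q = deriv P.U (q j) + deriv P.V (q j - q i) - deriv P.V (q k - q j) := by
  rw [P.dPotential_eq_closed, dif_pos (by omega : 0 < j.val), dif_pos (by omega : j.val + 1 < N)]
  have e1 : (⟨j.val - 1, by omega⟩ : Fin N) = i := Fin.ext (by simp only; omega)
  have e2 : (⟨j.val + 1, by omega⟩ : Fin N) = k := Fin.ext (by simp only; omega)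
  rw [e1, e2]

/-- `∂Φ/∂q_j = U'(q_j) + V'(q_j - q_i)` at the right end `j = N - 1` with left neighbour `i`. [folklore] -/
theorem dPotential_rightEnd (P : OscillatorChain) {i j : Fin N} (hij : j.val = i.val + 1) (hj : j.val = N - 1)
    (q : Fin N → ℝ) :
    P.dPotential N j q = deriv P.U (q j) + deriv P.V (q j - q i) := by
  rw [P.dPotential_eq_closed, dif_pos (by omega : 0 < j.val), dif_neg (by omega : ¬ j.val + 1 < N), sub_zero]
  have e1 : (⟨j.val - 1, by omega⟩ : Fin N) = i := Fin.ext (by simp only; omega)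
  rw [e1]

/-- The last site carries no bond current: `j_{N-1} = 0`. [folklore] -/
theorem bondCurrent_last (P : OscillatorChain) {i : Fin N} (hi : i.val = N - 1) (x : PhaseSpace N) :
    P.bondCurrent N i x = 0 := by
  unfold OscillatorChain.bondCurrent
  refine Finset.sum_eq_zero fun j _ => ?_
  rw [if_neg]
  have := j.isLt
  omega

/-- `∑_{i : Fin N} [i + 1 < N] c = (N - 1) c`. [folklore] -/
theorem sum_ite_succ_lt (N : ℕ) (hN : 0 < N) (c : ℝ) :
    ∑ i : Fin N, (if i.val + 1 < N then c else 0) = ((N : ℝ) - 1) * c := by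
  obtain ⟨M, rfl⟩ : ∃ M, N = M + 1 := ⟨N - 1, by omega⟩
  rw [Fin.sum_univ_castSucc]
  have h1 : ∀ i : Fin M, (if (Fin.castSucc i).val + 1 < M + 1 then c else 0) = c := fun i => by
    rw [if_pos]; simp [i.isLt]
  simp only [h1, Finset.sum_const, Finset.card_univ, Fintype.card_fin, nsmul_eq_mul, Fin.val_last,
    lt_self_iff_false, if_false, add_zero]
  push_cast; ring

/-! ### Pointwise bounds and integrability of the elementary fluxes under polynomial moments -/

section Integrability

variable {P : OscillatorChain} (hU0 : ∀ q, 0 ≤ P.U q) (hV0 : ∀ r, 0 ≤ P.V r) {μ : Measure (PhaseSpace N)}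
  (hmom : ∀ m : ℕ, Integrable (fun x => (1 + P.hamiltonian N x) ^ m) μ)

include hU0 hV0 in
/-- `|p_l U'(q_i)| ≤ A (1 + H)²` when `|U'| ≤ A(1 + U)` (`U, V ≥ 0`). [folklore] -/
theorem abs_momentum_mul_deriv_U_le {A : ℝ} (hA0 : 0 ≤ A) (hA : ∀ q, |deriv P.U q| ≤ A * (1 + P.U q))
    (x : PhaseSpace N) (l i : Fin N) :
    |x.2 l * deriv P.U (x.1 i)| ≤ A * (1 + P.hamiltonian N x) ^ 2 := by
  rw [abs_mul]
  have h1 := P.site_le_hamiltonian hU0 hV0 N x i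
  have hp := abs_momentum_le_one_add hU0 hV0 x l
  have hU' := hA (x.1 i)
  have hH := P.hamiltonian_nonneg_of_nonneg hU0 hV0 N x
  calc |x.2 l| * |deriv P.U (x.1 i)| ≤ (1 + P.hamiltonian N x) * (A * (1 + P.hamiltonian N x)) := by
        refine mul_le_mul hp (hU'.trans (mul_le_mul_of_nonneg_left ?_ hA0)) (abs_nonneg _) (by positivity)
        nlinarith [sq_nonneg (x.2 i)]
    _ = _ := by ring

include hU0 hV0 in
/-- `|p_l V'(q_j - q_i)| ≤ B (1 + H)²` for a bond `j = i + 1` when `|V'| ≤ B(1 + V)`. [folklore] -/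
theorem abs_momentum_mul_deriv_V_le {B : ℝ} (hB0 : 0 ≤ B) (hB : ∀ r, |deriv P.V r| ≤ B * (1 + P.V r))
    (x : PhaseSpace N) (l : Fin N) {i j : Fin N} (hij : j.val = i.val + 1) :
    |x.2 l * deriv P.V (x.1 j - x.1 i)| ≤ B * (1 + P.hamiltonian N x) ^ 2 := by
  rw [abs_mul]
  have h1 := P.bond_le_hamiltonian hU0 hV0 N x hij
  have hp := abs_momentum_le_one_add hU0 hV0 x l
  have hV' := hB (x.1 j - x.1 i)
  have hH := P.hamiltonian_nonneg_of_nonneg hU0 hV0 N x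
  calc |x.2 l| * |deriv P.V (x.1 j - x.1 i)| ≤ (1 + P.hamiltonian N x) * (B * (1 + P.hamiltonian N x)) :=
        mul_le_mul hp (hV'.trans (mul_le_mul_of_nonneg_left (by linarith) hB0)) (abs_nonneg _) (by positivity)
    _ = _ := by ring

include hU0 hV0 in
/-- `|p_l ∂_{q_i}H| ≤ (A + N²B)(1 + H)²` when `|U'| ≤ A(1 + U)`, `|V'| ≤ B(1 + V)`. [folklore] -/
theorem abs_momentum_mul_partialQ_le {A B : ℝ} (hA0 : 0 ≤ A) (hB0 : 0 ≤ B)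
    (hA : ∀ q, |deriv P.U q| ≤ A * (1 + P.U q)) (hB : ∀ r, |deriv P.V r| ≤ B * (1 + P.V r))
    (hUd : Differentiable ℝ P.U) (hVd : Differentiable ℝ P.V) (x : PhaseSpace N) (l i : Fin N) :
    |x.2 l * partialQ i (P.hamiltonian N) x| ≤ (A + N ^ 2 * B) * (1 + P.hamiltonian N x) ^ 2 := by
  rw [abs_mul]
  have hp := abs_momentum_le_one_add hU0 hV0 x l
  have hF := abs_partialQ_hamiltonian_le hU0 hV0 hA0 hB0 hA hB hUd hVd x i
  have hH := P.hamiltonian_nonneg_of_nonneg hU0 hV0 N x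
  calc |x.2 l| * |partialQ i (P.hamiltonian N) x| ≤
      (1 + P.hamiltonian N x) * ((A + N ^ 2 * B) * (1 + P.hamiltonian N x)) :=
        mul_le_mul hp hF (abs_nonneg _) (by positivity)
    _ = _ := by ring

include hmom in
/-- A continuous observable dominated by `K (1 + H)^m` is integrable. [folklore] -/
theorem integrable_of_abs_le_pow {g : PhaseSpace N → ℝ} (hg : Continuous g) {K : ℝ} {m : ℕ}
    (hb : ∀ x, |g x| ≤ K * (1 + P.hamiltonian N x) ^ m) : Integrable g μ :=
  ((hmom m).const_mul K).mono' hg.aestronglyMeasurable (Eventually.of_forall fun x => by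
    rw [Real.norm_eq_abs]; exact hb x)

include hmom in
/-- A continuous observable dominated by `K (1 + H)^m` is square integrable. [folklore] -/
theorem integrable_sq_of_abs_le_pow {g : PhaseSpace N → ℝ} (hg : Continuous g) {K : ℝ} {m : ℕ}
    (hb : ∀ x, |g x| ≤ K * (1 + P.hamiltonian N x) ^ m) : Integrable (fun x => g x ^ 2) μ := by
  refine integrable_of_abs_le_pow hmom (hg.pow 2) (K := K ^ 2) (m := 2 * m) fun x => ?_
  rw [abs_pow, pow_mul', ← mul_pow]
  exact pow_le_pow_left₀ (abs_nonneg _) (hb x) 2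

include hU0 hV0 hmom

/-- `p_l U'(q_i) ∈ L¹(μ)`. [folklore] -/
theorem integrable_momentum_mul_deriv_U (hUc : Continuous (deriv P.U)) {A : ℝ} (hA0 : 0 ≤ A)
    (hA : ∀ q, |deriv P.U q| ≤ A * (1 + P.U q)) (l i : Fin N) :
    Integrable (fun x : PhaseSpace N => x.2 l * deriv P.U (x.1 i)) μ :=
  integrable_of_abs_le_pow hmom (by fun_prop) (abs_momentum_mul_deriv_U_le hU0 hV0 hA0 hA · l i)

/-- `p_l V'(q_j - q_i) ∈ L¹(μ)` for a bond `j = i + 1`. [folklore] -/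
theorem integrable_momentum_mul_deriv_V (hVc : Continuous (deriv P.V)) {B : ℝ} (hB0 : 0 ≤ B)
    (hB : ∀ r, |deriv P.V r| ≤ B * (1 + P.V r)) (l : Fin N) {i j : Fin N} (hij : j.val = i.val + 1) :
    Integrable (fun x : PhaseSpace N => x.2 l * deriv P.V (x.1 j - x.1 i)) μ :=
  integrable_of_abs_le_pow hmom (by fun_prop) (fun x => abs_momentum_mul_deriv_V_le hU0 hV0 hB0 hB x l hij)

/-- `p_l ∂_{q_i}H ∈ L¹(μ)`. [folklore] -/
theorem integrable_momentum_mul_partialQ (hH1 : ContDiff ℝ 1 (P.hamiltonian N)) {A B : ℝ} (hA0 : 0 ≤ A)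
    (hB0 : 0 ≤ B) (hA : ∀ q, |deriv P.U q| ≤ A * (1 + P.U q)) (hB : ∀ r, |deriv P.V r| ≤ B * (1 + P.V r))
    (hUd : Differentiable ℝ P.U) (hVd : Differentiable ℝ P.V) (l i : Fin N) :
    Integrable (fun x : PhaseSpace N => x.2 l * partialQ i (P.hamiltonian N) x) μ := by
  have hc : Continuous (partialQ i (P.hamiltonian N)) := P.continuous_partialQ_hamiltonian hH1 i
  exact integrable_of_abs_le_pow hmom (by fun_prop) (abs_momentum_mul_partialQ_le hU0 hV0 hA0 hB0 hA hB hUd hVd · l i)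

end Integrability

/-! ### The steady currents -/

/-- **Equality of the steady bond currents** (registered sub-goal of `stub_steadyHeatRates`). For the pinned
chain (`ω₂ > 0`, `lam, β, γ ≥ 0`, `N ≥ 2`, `T_L, T_R ≥ 0`), bath sites `i0 = 0`, `iN = N - 1`, and a probability
measure `μ` which is weakly stationary (`∫ L g dμ = 0` for `g ∈ C_c^∞`) with all moments `(1 + H)^m ∈ L¹(μ)`:
every real bond carries the mean current `∫ j_b dμ = W_0 := ∫ p_0 ∂_{q_0}H dμ`, the total current is
`(N - 1) W_0`, and `∫ p_{N-1} ∂_{q_{N-1}}H dμ = -W_0`. Proof: weak stationarity on `U(q_i)`, `V(q_{i+1} - q_i)`,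
`p_i²/2` (helpers 2, 3) gives `μ(p_iU'_i) = 0`, `μ(p_{i+1}V'_i) = μ(p_iV'_i) =: a_i` (so `μ(j_i) = -a_i`) and
`W_i = 0` inside; the closed form of `∂_{q_i}H` gives `W_0 = -a_0`, `W_i = a_{i-1} - a_i` inside, `W_{N-1} = a_{N-2}`.
[folklore] -/
theorem pinnedChain_steadyCurrents :
    ∀ (ω₂ lam β γ : ℝ), 0 < ω₂ → 0 ≤ lam → 0 ≤ β → 0 ≤ γ → ∀ (N : ℕ) (i0 iN : Fin N), 2 ≤ N → i0.val = 0 →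
    iN.val = N - 1 → ∀ (T_L T_R : ℝ), 0 ≤ T_L → 0 ≤ T_R → ∀ (μ : Measure (PhaseSpace N)) [IsProbabilityMeasure μ],
    (∀ g : PhaseSpace N → ℝ, ContDiff ℝ ((⊤ : ℕ∞) : WithTop ℕ∞) g → HasCompactSupport g →
      ∫ x, (pinnedChain ω₂ lam β γ).generator N T_L T_R g x ∂μ = 0) →
    (∀ m : ℕ, Integrable (fun x => (1 + (pinnedChain ω₂ lam β γ).hamiltonian N x) ^ m) μ) →
    (∀ ib : Fin N, ib.val + 1 < N →
      ∫ x, (pinnedChain ω₂ lam β γ).bondCurrent N ib x ∂μ =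
        ∫ x, x.2 i0 * partialQ i0 ((pinnedChain ω₂ lam β γ).hamiltonian N) x ∂μ) ∧
    (pinnedChain ω₂ lam β γ).totalCurrent μ =
      ((N : ℝ) - 1) * ∫ x, x.2 i0 * partialQ i0 ((pinnedChain ω₂ lam β γ).hamiltonian N) x ∂μ ∧
    ∫ x, x.2 iN * partialQ iN ((pinnedChain ω₂ lam β γ).hamiltonian N) x ∂μ =
      -∫ x, x.2 i0 * partialQ i0 ((pinnedChain ω₂ lam β γ).hamiltonian N) x ∂μ := by
  intro ω₂ lam β γ hω hl hβ hγ N i0 iN hN hi0 hiN T_L T_R hTL hTR μ _ hweak hmom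
  -- notation
  have hN0 : 0 < N := by omega
  have hP := pinnedChain_isConfining hω hl hβ hγ
  have hUd := hP.differentiable_U
  have hVd := hP.differentiable_V
  have hU0 := hP.U_nonneg
  have hV0 := hP.V_nonneg
  obtain ⟨A, hA0, hA⟩ := hP.exists_abs_deriv_U_le
  obtain ⟨B, hB0, hB⟩ := hP.exists_abs_deriv_V_le
  have hUc : Continuous (deriv (pinnedChain ω₂ lam β γ).U) := hP.contDiff_U.continuous_deriv (by norm_num)
  have hVc : Continuous (deriv (pinnedChain ω₂ lam β γ).V) := hP.contDiff_V.continuous_deriv (by norm_num)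
  have hUs : ContDiff ℝ ∞ (pinnedChain ω₂ lam β γ).U := pinnedChain_contDiff_U ω₂ lam β γ
  have hVs : ContDiff ℝ ∞ (pinnedChain ω₂ lam β γ).V := pinnedChain_contDiff_V ω₂ lam β γ
  obtain ⟨C, hk, hLk, hPk, hu, hLu, hPu, hv, hLv, hPv⟩ :=
    pinnedChain_elementaryBounds ω₂ lam β γ hω hl hβ hγ N T_L T_R
  have LemmaA := pinnedChain_integral_generator_eq_zero_of_growth ω₂ lam β γ hω hl hβ hγ N hN0 T_L T_R hTL hTR μ
    hweak hmom
  have hq : ∀ i : Fin N, ContDiff ℝ ∞ fun z : PhaseSpace N => z.1 i := fun i =>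
    (contDiff_apply ℝ ℝ i).comp contDiff_fst
  have hp : ∀ i : Fin N, ContDiff ℝ ∞ fun z : PhaseSpace N => z.2 i := fun i =>
    (contDiff_apply ℝ ℝ i).comp contDiff_snd
  -- (IU) `μ(p_i U'(q_i)) = 0`
  have IU : ∀ i : Fin N, ∫ x, x.2 i * deriv (pinnedChain ω₂ lam β γ).U (x.1 i) ∂μ = 0 := by
    intro i
    have h := LemmaA (fun z => (pinnedChain ω₂ lam β γ).U (z.1 i)) C 2 (hUs.comp (hq i)) (hu i) (hLu i)
      (fun l x => hPu i l x)
    simpa only [generator_pinning] using h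
  -- (IV) `μ(p_j V'(q_j - q_i)) = μ(p_i V'(q_j - q_i))` for a bond
  have IV : ∀ (i j : Fin N), j.val = i.val + 1 →
      ∫ x, x.2 j * deriv (pinnedChain ω₂ lam β γ).V (x.1 j - x.1 i) ∂μ =
        ∫ x, x.2 i * deriv (pinnedChain ω₂ lam β γ).V (x.1 j - x.1 i) ∂μ := by
    intro i j hij
    have hne : i ≠ j := by intro h; rw [h] at hij; omega
    have h := LemmaA (fun z => (pinnedChain ω₂ lam β γ).V (z.1 j - z.1 i)) C 2 (hVs.comp ((hq j).sub (hq i)))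
      (fun x => hv i j x hij) (fun x => hLv i j x hij) (fun l x => hPv i j l x)
    simp only [generator_bondEnergy _ hVd T_L T_R hne, sub_mul] at h
    rw [integral_sub (integrable_momentum_mul_deriv_V hU0 hV0 hmom hVc hB0 hB j hij) (integrable_momentum_mul_deriv_V hU0 hV0 hmom hVc hB0 hB i hij)]
      at h
    linarith
  -- (IK) at interior sites: `W_j = 0`
  have IK : ∀ j : Fin N, j.val ≠ 0 → j.val ≠ N - 1 →
      ∫ x, x.2 j * partialQ j ((pinnedChain ω₂ lam β γ).hamiltonian N) x ∂μ = 0 := by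
    intro j hj0 hjN
    have h := LemmaA (fun z => z.2 j ^ 2 / 2) C 2 (((hp j).pow 2).div_const 2) (hk j) (hLk j) (fun l x => hPk j l x)
    simp only [generator_kinetic, hj0, hjN, if_false, add_zero, mul_zero] at h
    rw [integral_neg, neg_eq_zero] at h
    exact h
  -- the current through a bond and the expansion of `W`
  have Jb : ∀ (i j : Fin N), j.val = i.val + 1 →
      ∫ x, (pinnedChain ω₂ lam β γ).bondCurrent N i x ∂μ =
        -∫ x, x.2 i * deriv (pinnedChain ω₂ lam β γ).V (x.1 j - x.1 i) ∂μ := by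
    intro i j hij
    have e : ∀ x, (pinnedChain ω₂ lam β γ).bondCurrent N i x =
        -(1 / 2) * (x.2 i * deriv (pinnedChain ω₂ lam β γ).V (x.1 j - x.1 i)) +
          -(1 / 2) * (x.2 j * deriv (pinnedChain ω₂ lam β γ).V (x.1 j - x.1 i)) := by
      intro x
      rw [bondCurrent_siteZero (pinnedChain ω₂ lam β γ) (i0 := i) (i1 := j) hij x]
      ring
    simp_rw [e]
    rw [integral_add ((integrable_momentum_mul_deriv_V hU0 hV0 hmom hVc hB0 hB i hij).const_mul _)
      ((integrable_momentum_mul_deriv_V hU0 hV0 hmom hVc hB0 hB j hij).const_mul _), integral_const_mul, integral_const_mul, IV i j hij]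
    ring
  have W0 : ∀ (j : Fin N), j.val = i0.val + 1 →
      ∫ x, x.2 i0 * partialQ i0 ((pinnedChain ω₂ lam β γ).hamiltonian N) x ∂μ =
        -∫ x, x.2 i0 * deriv (pinnedChain ω₂ lam β γ).V (x.1 j - x.1 i0) ∂μ := by
    intro j hj
    have e : ∀ x : PhaseSpace N, x.2 i0 * partialQ i0 ((pinnedChain ω₂ lam β γ).hamiltonian N) x =
        x.2 i0 * deriv (pinnedChain ω₂ lam β γ).U (x.1 i0) - x.2 i0 * deriv (pinnedChain ω₂ lam β γ).V (x.1 j - x.1 i0) := by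
      intro x
      rw [(pinnedChain ω₂ lam β γ).partialQ_hamiltonian_eq_dPotential hUd hVd,
        dPotential_siteZero (pinnedChain ω₂ lam β γ) (i0 := i0) (i1 := j) hi0 (by omega) x.1]
      ring
    simp_rw [e]
    rw [integral_sub (integrable_momentum_mul_deriv_U hU0 hV0 hmom hUc hA0 hA i0 i0) (integrable_momentum_mul_deriv_V hU0 hV0 hmom hVc hB0 hB i0 hj),
      IU i0]
    ring
  have Wmid : ∀ (i j k : Fin N), j.val = i.val + 1 → k.val = j.val + 1 →
      ∫ x, x.2 j * deriv (pinnedChain ω₂ lam β γ).V (x.1 k - x.1 j) ∂μ =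
        ∫ x, x.2 i * deriv (pinnedChain ω₂ lam β γ).V (x.1 j - x.1 i) ∂μ := by
    intro i j k hij hjk
    have e : ∀ x : PhaseSpace N, x.2 j * partialQ j ((pinnedChain ω₂ lam β γ).hamiltonian N) x =
        x.2 j * deriv (pinnedChain ω₂ lam β γ).U (x.1 j) + x.2 j * deriv (pinnedChain ω₂ lam β γ).V (x.1 j - x.1 i) -
          x.2 j * deriv (pinnedChain ω₂ lam β γ).V (x.1 k - x.1 j) := by
      intro x
      rw [(pinnedChain ω₂ lam β γ).partialQ_hamiltonian_eq_dPotential hUd hVd,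
        dPotential_interior (pinnedChain ω₂ lam β γ) hij hjk x.1]
      ring
    have h := IK j (by omega) (by have := k.isLt; omega)
    simp_rw [e] at h
    have hI : Integrable (fun x : PhaseSpace N => x.2 j * deriv (pinnedChain ω₂ lam β γ).U (x.1 j) +
        x.2 j * deriv (pinnedChain ω₂ lam β γ).V (x.1 j - x.1 i)) μ :=
      (integrable_momentum_mul_deriv_U hU0 hV0 hmom hUc hA0 hA j j).add (integrable_momentum_mul_deriv_V hU0 hV0 hmom hVc hB0 hB j hij)
    rw [integral_sub hI (integrable_momentum_mul_deriv_V hU0 hV0 hmom hVc hB0 hB j hjk),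
      integral_add (integrable_momentum_mul_deriv_U hU0 hV0 hmom hUc hA0 hA j j) (integrable_momentum_mul_deriv_V hU0 hV0 hmom hVc hB0 hB j hij),
      IU j, IV i j hij] at h
    linarith
  have WN : ∀ (i : Fin N), iN.val = i.val + 1 →
      ∫ x, x.2 iN * partialQ iN ((pinnedChain ω₂ lam β γ).hamiltonian N) x ∂μ =
        ∫ x, x.2 i * deriv (pinnedChain ω₂ lam β γ).V (x.1 iN - x.1 i) ∂μ := by
    intro i hi
    have e : ∀ x : PhaseSpace N, x.2 iN * partialQ iN ((pinnedChain ω₂ lam β γ).hamiltonian N) x =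
        x.2 iN * deriv (pinnedChain ω₂ lam β γ).U (x.1 iN) + x.2 iN * deriv (pinnedChain ω₂ lam β γ).V (x.1 iN - x.1 i) := by
      intro x
      rw [(pinnedChain ω₂ lam β γ).partialQ_hamiltonian_eq_dPotential hUd hVd,
        dPotential_rightEnd (pinnedChain ω₂ lam β γ) hi hiN x.1]
      ring
    simp_rw [e]
    rw [integral_add (integrable_momentum_mul_deriv_U hU0 hV0 hmom hUc hA0 hA iN iN) (integrable_momentum_mul_deriv_V hU0 hV0 hmom hVc hB0 hB iN hi),
      IU iN, IV i iN hi]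
    ring
  -- all bond integrals agree with the first one
  set i1 : Fin N := ⟨1, by omega⟩ with hi1
  have hall : ∀ (n : ℕ) (i j : Fin N), i.val = n → j.val = n + 1 →
      ∫ x, x.2 i * deriv (pinnedChain ω₂ lam β γ).V (x.1 j - x.1 i) ∂μ =
        ∫ x, x.2 i0 * deriv (pinnedChain ω₂ lam β γ).V (x.1 i1 - x.1 i0) ∂μ := by
    intro n
    induction n with
    | zero =>
      intro i j hi hj
      have e1 : i = i0 := Fin.ext (by omega)
      have e2 : j = i1 := Fin.ext (by rw [hj, hi1])
      subst e1 e2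
      rfl
    | succ m ih =>
      intro j k hj hk
      have him : m < N := by omega
      rw [Wmid ⟨m, him⟩ j k (by simpa using hj) (by omega)]
      exact ih ⟨m, him⟩ j rfl (by simpa using hj)
  -- conclusions
  have hW0 := W0 i1 (by rw [hi1, hi0])
  refine ⟨fun ib hib => ?_, ?_, ?_⟩
  · rw [Jb ib ⟨ib.val + 1, hib⟩ rfl, hall ib.val ib ⟨ib.val + 1, hib⟩ rfl rfl, hW0]
  · have hterm : ∀ i : Fin N, ∫ x, (pinnedChain ω₂ lam β γ).bondCurrent N i x ∂μ =
        if i.val + 1 < N then ∫ x, x.2 i0 * partialQ i0 ((pinnedChain ω₂ lam β γ).hamiltonian N) x ∂μ else 0 := by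
      intro i
      split_ifs with h
      · rw [Jb i ⟨i.val + 1, h⟩ rfl, hall i.val i ⟨i.val + 1, h⟩ rfl rfl, hW0]
      · simp_rw [bondCurrent_last (pinnedChain ω₂ lam β γ) (show i.val = N - 1 by have := i.isLt; omega)]
        simp
    unfold OscillatorChain.totalCurrent
    simp_rw [hterm]
    exact sum_ite_succ_lt N hN0 _
  · have hi : iN.val = (⟨N - 2, by omega⟩ : Fin N).val + 1 := by simp only; omega
    rw [WN ⟨N - 2, by omega⟩ hi, hall (N - 2) ⟨N - 2, by omega⟩ iN rfl (by omega), hW0, neg_neg]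

end Summit.AtomisticToContinuum.FouriersLaw.Theorems.LinearResponseFTUR

end
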